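import Mathlib
import HarnessLib
import Summits.Ventures.LatticeQCDFlow.Exactness.NCMCGeneralSpaceBennettBlocksRoot
import Summits.Ventures.LatticeQCDFlow.Exactness.NCMCGeneralSpaceBennettRootStudentizedCLT

/-!
# The studentized Bennett estimate with unequal sample sizes: `ΔF̂ ± z·√(1/(n Ĝ_{a,b}) − 1/nf − 1/nr)` is asymptotically exact

HONEST FRAMING: exact (Metropolis-corrected) sampling algorithms for lattice gauge theory;
figures of merit are autocorrelation/cost numbers at stated couplings and volumes; no
continuum-physics claim.

Venture `LatticeQCDFlow` (cell pub-lqcd), topic `Exactness`; FANOUT row 13 (`eng-snf`, GEN-15).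
NEW WORK of the cell (a Lipschitz plug-in, the strong law, Slutsky, one implication of the
portmanteau theorem), not a published result; nothing is cited as a fact (C. H. Bennett, J. Comput.
Phys. 22 (1976) 245 — the variance formula for the acceptance-ratio estimate — named only).  The `a : b` version of
`NCMCGeneralSpaceBennettRootStudentizedCLT.lean` (GEN-15 (41)), on top of
`NCMCGeneralSpaceBennettBlocksRoot.lean` ((46b): `√n (ΔF̂_n − ΔF) →d N(0, 1/G_{a,b} − 1/a − 1/b)`).

## Content

Blocks `ω i ∈ (Fin a → E) × (Fin b → E)` of `a` forward and `b` reverse evolutions, shift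
`M = log(a/b)`, `ΔF̂_n` a measurable root of the block Bennett equation.  The PLUG-IN OVERLAP is
`Ĝ_n = (1/n) Σ_{i<n} Σ_{l<a} σ(ΔF̂_n − M − W((ω i).1 l))` — the summed Fermi acceptance-probabilities
of the forward works at the reported root, per block; its limit is Bennett's
`G_{a,b} = E_{P_R}[(e^{ΔF−W}/a + 1/b)⁻¹] = a E_{P_F} σ(ΔF − M − W)`.

* **`tendsto_blockOverlapHat_ae`** — for a.e. run (one null set), along EVERY sequence `d_n → d⋆`,
  `(1/n) Σ_{i<n} Σ_l σ(d_n − M − W((ω i).1 l)) → a E_{μF} σ(d⋆ − M − W)`.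
* **`CrooksPair.tendsto_blockOverlapHat_ae`** — hence `Ĝ_n → G_{a,b}` a.s. at the BAR root.
* **`CrooksPair.tendstoInDistribution_barRoot_blocks_studentized`** — if the limiting variance
  `1/G_{a,b} − 1/a − 1/b` is positive, `√n (ΔF̂_n − ΔF)/√(1/Ĝ_n − 1/a − 1/b) →d N(0, 1)`.
* **`CrooksPair.tendsto_measure_abs_barRoot_blocks_sub_le`** — COVERAGE: for `z ≥ 0` the probability
  of `|ΔF̂_n − ΔF| √n ≤ z √(1/Ĝ_n − 1/a − 1/b)` tends to `gaussianReal 0 1 [−z, z]`.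
  Reading for the engine (`snf.estimators.bar` with `nf = a n`, `nr = b n`): the honest large-sample
  error bar is `√(1/(n Ĝ_n) − 1/nf − 1/nr)` — Bennett's variance formula with the overlap estimated by
  the summed forward Fermi acceptances at the root, `n Ĝ_n = Σ_{forward works} σ(ΔF̂ − M − W)`.

Scope / NOT CLAIMED: fixed ratio `a : b`, independent evolutions; no rate / finite-`n` coverage; the
degenerate case `1/G_{a,b} = 1/a + 1/b` excluded; no value for any protocol.
-/

namespace Summit.Ventures.LatticeQCDFlow.Exactness.GeneralNCMC

open MeasureTheory ProbabilityTheory Set Filter Finset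
open scoped ENNReal NNReal Topology

variable {E : Type*} [MeasurableSpace E]

/-! ## The plug-in block overlap along any sequence converging to the root -/

section TwoLaws

variable (μF μR : Measure E) [IsProbabilityMeasure μF] [IsProbabilityMeasure μR]
variable {W : E → ℝ} (M : ℝ) {a b : ℕ}

/-- **The plug-in block overlap is strongly consistent along every sequence tending to `d⋆`**: for
almost every run of blocks (one null set), for EVERY real sequence `d_n → d⋆`,
`(1/n) Σ_{i<n} Σ_{l<a} σ(d_n − M − W((ω i).1 l)) → a E_{μF} σ(d⋆ − M − W)`. -/
theorem tendsto_blockOverlapHat_ae (hW : Measurable W) (dstar : ℝ) :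
    ∀ᵐ ω ∂(Measure.infinitePi fun _ : ℕ =>
        (Measure.pi fun _ : Fin a => μF).prod (Measure.pi fun _ : Fin b => μR)), ∀ dseq : ℕ → ℝ,
      Tendsto dseq atTop (𝓝 dstar) →
      Tendsto (fun n : ℕ => (∑ i ∈ range n, ∑ l, Real.sigmoid (dseq n - M - W ((ω i).1 l))) / n) atTop
        (𝓝 (a * ∫ x, Real.sigmoid (dstar - M - W x) ∂μF)) := by
  set μ := (Measure.pi fun _ : Fin a => μF).prod (Measure.pi fun _ : Fin b => μR) with hμ
  have hσ : Measurable Real.sigmoid := _root_.continuous_sigmoid.measurable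
  have hm : Measurable fun p : (Fin a → E) × (Fin b → E) => ∑ l, Real.sigmoid (dstar - M - W (p.1 l)) :=
    Finset.measurable_sum _ fun l _ =>
      hσ.comp (measurable_const.sub (hW.comp ((measurable_pi_apply l).comp measurable_fst)))
  have hiF : Integrable (fun x : Fin a → E => ∑ l, Real.sigmoid (dstar - M - W (x l)))
      (Measure.pi fun _ : Fin a => μF) := by
    refine integrable_finsetSum _ fun l _ => ?_
    exact (measurePreserving_eval (fun _ : Fin a => μF) l).integrable_comp_of_integrable
      (integrable_sigmoid_comp (measurable_const.sub hW))
  have hi : Integrable (fun p : (Fin a → E) × (Fin b → E) => ∑ l, Real.sigmoid (dstar - M - W (p.1 l))) μ :=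
    (measurePreserving_fst (μ := Measure.pi fun _ : Fin a => μF)
      (ν := Measure.pi fun _ : Fin b => μR)).integrable_comp_of_integrable hiF
  have hmean : ∫ p, (∑ l, Real.sigmoid (dstar - M - W (p.1 l))) ∂μ =
      a * ∫ x, Real.sigmoid (dstar - M - W x) ∂μF := by
    rw [integral_comp_of_measurePreserving
        (measurePreserving_fst (μ := Measure.pi fun _ : Fin a => μF) (ν := Measure.pi fun _ : Fin b => μR))
        hiF.aestronglyMeasurable,
      integral_blockSum μF (g := fun x => Real.sigmoid (dstar - M - W x))
        (integrable_sigmoid_comp (measurable_const.sub hW))]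
  filter_upwards [tendsto_sampleMean_ae μ hm hi] with ω hω dseq hdseq
  rw [hmean] at hω
  have hS : Tendsto (fun n : ℕ => (∑ i ∈ range n, ∑ l, Real.sigmoid (dstar - M - W ((ω i).1 l))) / n)
      atTop (𝓝 (a * ∫ x, Real.sigmoid (dstar - M - W x) ∂μF)) := by
    refine hω.congr fun n => ?_
    unfold sampleMean
    rw [Fin.sum_univ_eq_sum_range (fun i => ∑ l, Real.sigmoid (dstar - M - W ((ω i).1 l))) n]
  -- the plug-in differs from the fixed-`d⋆` mean by at most `(a/4)|d_n − d⋆|`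
  have hblock : ∀ n i, |(∑ l, Real.sigmoid (dseq n - M - W ((ω i).1 l))) -
      ∑ l, Real.sigmoid (dstar - M - W ((ω i).1 l))| ≤ (a : ℝ) / 4 * |dseq n - dstar| := by
    intro n i
    rw [← sum_sub_distrib]
    calc |∑ l, (Real.sigmoid (dseq n - M - W ((ω i).1 l)) - Real.sigmoid (dstar - M - W ((ω i).1 l)))|
        ≤ ∑ l, |Real.sigmoid (dseq n - M - W ((ω i).1 l)) - Real.sigmoid (dstar - M - W ((ω i).1 l))| :=
          abs_sum_le_sum_abs _ _
      _ ≤ ∑ _l : Fin a, 1 / 4 * |dseq n - dstar| := sum_le_sum fun l _ => by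
          have := abs_sigmoid_sub_sigmoid_le (dseq n - M - W ((ω i).1 l)) (dstar - M - W ((ω i).1 l))
          rwa [show dseq n - M - W ((ω i).1 l) - (dstar - M - W ((ω i).1 l)) = dseq n - dstar by ring]
            at this
      _ = (a : ℝ) / 4 * |dseq n - dstar| := by
          rw [sum_const, card_univ, Fintype.card_fin, nsmul_eq_mul]; ring
  have hdiff : ∀ n : ℕ, |(∑ i ∈ range n, ∑ l, Real.sigmoid (dseq n - M - W ((ω i).1 l))) / n -
      (∑ i ∈ range n, ∑ l, Real.sigmoid (dstar - M - W ((ω i).1 l))) / n| ≤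
      (a : ℝ) / 4 * |dseq n - dstar| := by
    intro n
    rcases Nat.eq_zero_or_pos n with rfl | hn
    · simp only [range_zero, sum_empty, CharP.cast_eq_zero, div_zero, sub_self, abs_zero]
      positivity
    · have hn' : (0 : ℝ) < n := by exact_mod_cast hn
      rw [← sub_div, ← sum_sub_distrib, abs_div, abs_of_pos hn', div_le_iff₀ hn']
      calc |∑ i ∈ range n, ((∑ l, Real.sigmoid (dseq n - M - W ((ω i).1 l))) -
            ∑ l, Real.sigmoid (dstar - M - W ((ω i).1 l)))|
          ≤ ∑ i ∈ range n, |(∑ l, Real.sigmoid (dseq n - M - W ((ω i).1 l))) -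
            ∑ l, Real.sigmoid (dstar - M - W ((ω i).1 l))| := abs_sum_le_sum_abs _ _
        _ ≤ ∑ _i ∈ range n, (a : ℝ) / 4 * |dseq n - dstar| := sum_le_sum fun i _ => hblock n i
        _ = (a : ℝ) / 4 * |dseq n - dstar| * n := by rw [sum_const, card_range, nsmul_eq_mul, mul_comm]
  have hgap : Tendsto (fun n : ℕ => (∑ i ∈ range n, ∑ l, Real.sigmoid (dseq n - M - W ((ω i).1 l))) / n -
      (∑ i ∈ range n, ∑ l, Real.sigmoid (dstar - M - W ((ω i).1 l))) / n) atTop (𝓝 0) := by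
    have hb : Tendsto (fun n => (a : ℝ) / 4 * |dseq n - dstar|) atTop (𝓝 0) := by
      have := ((hdseq.sub_const dstar).abs).const_mul ((a : ℝ) / 4)
      rwa [sub_self, abs_zero, mul_zero] at this
    exact squeeze_zero_norm (fun n => by rw [Real.norm_eq_abs]; exact hdiff n) hb
  have := hgap.add hS
  rw [zero_add] at this
  exact this.congr fun n => by ring

end TwoLaws

/-! ## Crooks pairs: the studentized block estimate and its coverage -/

namespace CrooksPair

variable {Ω : Type*} [MeasurableSpace Ω]
variable {ν₀ ν₁ : Measure Ω} {κF κR : Kernel Ω E} {s e : E → Ω} {W : E → ℝ} {a b : ℕ}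
variable {Ω' : Type*} [MeasurableSpace Ω'] {P' : Measure Ω'} [IsProbabilityMeasure P']

/-- **The plug-in block overlap converges to Bennett's `G_{a,b}`**: for any root selection `d̂` of
the block Bennett equation, `Ĝ_n = (1/n) Σ_{i<n} Σ_l σ(d̂_n − M − W((ω i).1 l)) → E_R[(e^{ΔF−W}/a + 1/b)⁻¹]`
almost surely. -/
theorem tendsto_blockOverlapHat_ae [IsFiniteMeasure ν₀] [IsFiniteMeasure ν₁]
    [IsMarkovKernel κF] [IsMarkovKernel κR] (h0 : ν₀ univ ≠ 0) (h1 : ν₁ univ ≠ 0)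
    (h : CrooksPair ν₀ ν₁ κF κR s e W) {ΔF : ℝ}
    (hΔF : Real.exp (-ΔF) = ((ν₀ univ)⁻¹ * ν₁ univ).toReal) (ha : 0 < a) (hb : 0 < b)
    {dhat : ℕ → (ℕ → (Fin a → E) × (Fin b → E)) → ℝ}
    (hdhat : ∀ n, 1 ≤ n → ∀ ω, ∑ i ∈ range n,
      ((∑ l, Real.sigmoid (dhat n ω - Real.log ((a : ℝ) / b) - W ((ω i).1 l))) -
        ∑ l, Real.sigmoid (W ((ω i).2 l) - (dhat n ω - Real.log ((a : ℝ) / b)))) = 0) :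
    haveI := isProbabilityMeasure_fwdPathLaw ν₀ h0 κF
    haveI := isProbabilityMeasure_fwdPathLaw ν₁ h1 κR
    ∀ᵐ ω ∂(Measure.infinitePi fun _ : ℕ =>
        (Measure.pi fun _ : Fin a => fwdPathLaw ν₀ κF).prod (Measure.pi fun _ : Fin b => fwdPathLaw ν₁ κR)),
      Tendsto (fun n : ℕ =>
        (∑ i ∈ range n, ∑ l, Real.sigmoid (dhat n ω - Real.log ((a : ℝ) / b) - W ((ω i).1 l))) / n) atTop
        (𝓝 (∫ ε, (Real.exp (ΔF - W ε) / a + 1 / b)⁻¹ ∂(fwdPathLaw ν₁ κR))) := by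
  haveI := isProbabilityMeasure_fwdPathLaw ν₀ h0 κF
  haveI := isProbabilityMeasure_fwdPathLaw ν₁ h1 κR
  have ha' : (0 : ℝ) < a := by exact_mod_cast ha
  have hc : (a : ℝ) * Real.exp (ΔF - Real.log ((a : ℝ) / b) - ΔF) = b := mul_exp_sub_log_div ha hb ΔF
  rw [h.inv_mul_overlap_eq_bennett_bound h0 h1 hΔF ha' hc]
  filter_upwards [h.tendsto_barRoot_blocks_ae h0 h1 hΔF ha hb,
    GeneralNCMC.tendsto_blockOverlapHat_ae (fwdPathLaw ν₀ κF) (fwdPathLaw ν₁ κR) (Real.log ((a : ℝ) / b))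
      (a := a) (b := b) h.measurable_W ΔF] with ω hωroot hωG
  exact hωG (fun n => dhat n ω) (hωroot _ (eventually_atTop.2 ⟨1, fun n hn => hdhat n hn ω⟩))

/-- **Studentized CLT for the self-consistent Bennett estimate with `nf : nr = a : b`.**  If the
limiting variance `1/G_{a,b} − 1/a − 1/b` is positive, then along independent blocks
`√n (ΔF̂_n − ΔF) / √(1/Ĝ_n − 1/a − 1/b) →d N(0, 1)`. -/
theorem tendstoInDistribution_barRoot_blocks_studentized [IsFiniteMeasure ν₀] [IsFiniteMeasure ν₁]
    [IsMarkovKernel κF] [IsMarkovKernel κR] (h0 : ν₀ univ ≠ 0) (h1 : ν₁ univ ≠ 0)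
    (h : CrooksPair ν₀ ν₁ κF κR s e W) {ΔF : ℝ}
    (hΔF : Real.exp (-ΔF) = ((ν₀ univ)⁻¹ * ν₁ univ).toReal) (ha : 0 < a) (hb : 0 < b)
    (hv : 0 < 1 / (∫ ε, (Real.exp (ΔF - W ε) / a + 1 / b)⁻¹ ∂(fwdPathLaw ν₁ κR)) - 1 / a - 1 / b)
    {dhat : ℕ → (ℕ → (Fin a → E) × (Fin b → E)) → ℝ} (hdm : ∀ n, Measurable (dhat n))
    (hdhat : ∀ n, 1 ≤ n → ∀ ω, ∑ i ∈ range n,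
      ((∑ l, Real.sigmoid (dhat n ω - Real.log ((a : ℝ) / b) - W ((ω i).1 l))) -
        ∑ l, Real.sigmoid (W ((ω i).2 l) - (dhat n ω - Real.log ((a : ℝ) / b)))) = 0)
    {Z : Ω' → ℝ} (hZ : HasLaw Z (gaussianReal 0 1) P') :
    haveI := isProbabilityMeasure_fwdPathLaw ν₀ h0 κF
    haveI := isProbabilityMeasure_fwdPathLaw ν₁ h1 κR
    TendstoInDistribution
      (fun (n : ℕ) (ω : ℕ → (Fin a → E) × (Fin b → E)) => √(n : ℝ) * (dhat n ω - ΔF) /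
        √(1 / ((∑ i ∈ range n, ∑ l, Real.sigmoid (dhat n ω - Real.log ((a : ℝ) / b) - W ((ω i).1 l))) / n)
          - 1 / a - 1 / b))
      atTop Z (fun _ => Measure.infinitePi fun _ : ℕ =>
        (Measure.pi fun _ : Fin a => fwdPathLaw ν₀ κF).prod (Measure.pi fun _ : Fin b => fwdPathLaw ν₁ κR)) P' := by
  haveI := isProbabilityMeasure_fwdPathLaw ν₀ h0 κF
  haveI := isProbabilityMeasure_fwdPathLaw ν₁ h1 κR
  set P := Measure.infinitePi fun _ : ℕ =>
    (Measure.pi fun _ : Fin a => fwdPathLaw ν₀ κF).prod (Measure.pi fun _ : Fin b => fwdPathLaw ν₁ κR) with hP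
  set M := Real.log ((a : ℝ) / b) with hM
  set G := ∫ ε, (Real.exp (ΔF - W ε) / a + 1 / b)⁻¹ ∂(fwdPathLaw ν₁ κR) with hGdef
  have ha' : (0 : ℝ) < a := by exact_mod_cast ha
  have hc : (a : ℝ) * Real.exp (ΔF - M - ΔF) = b := mul_exp_sub_log_div ha hb ΔF
  have hGpos : 0 < G := by
    rw [hGdef, h.inv_mul_overlap_eq_bennett_bound h0 h1 hΔF ha' hc]
    exact h.mul_overlap_pos h0 ha' _
  set v := 1 / G - 1 / a - 1 / b with hvdef
  have hsv : √v ≠ 0 := (Real.sqrt_pos.2 hv).ne'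
  have hY : HasLaw (fun ω' => √v * Z ω') (gaussianReal 0 (1 / G - 1 / a - 1 / b).toNNReal) P' := by
    have h' := gaussianReal_const_mul hZ (√v)
    rw [mul_zero, mul_one] at h'
    convert h' using 3
    apply NNReal.eq
    rw [Real.coe_toNNReal _ hv.le, NNReal.coe_mk, Real.sq_sqrt hv.le]
  have clt := h.tendstoInDistribution_sqrt_mul_barRoot_blocks_sub h0 h1 hΔF ha hb hdm hdhat hY
  have hGm : ∀ n : ℕ, Measurable fun ω : ℕ → (Fin a → E) × (Fin b → E) =>
      (∑ i ∈ range n, ∑ l, Real.sigmoid (dhat n ω - M - W ((ω i).1 l))) / n := fun n =>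
    (Finset.measurable_sum _ fun i _ => Finset.measurable_sum _ fun l _ =>
      _root_.continuous_sigmoid.measurable.comp (((hdm n).sub_const M).sub
        (h.measurable_W.comp ((measurable_pi_apply l).comp
          (measurable_fst.comp (measurable_pi_apply i)))))).div_const _
  have hUmeas : ∀ n : ℕ, AEMeasurable (fun ω : ℕ → (Fin a → E) × (Fin b → E) =>
      (√(1 / ((∑ i ∈ range n, ∑ l, Real.sigmoid (dhat n ω - M - W ((ω i).1 l))) / n) - 1 / a - 1 / b))⁻¹) P :=
    fun n => ((((hGm n).const_div 1).sub_const _).sub_const _).sqrt.inv.aemeasurable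
  have hU : TendstoInMeasure P (fun (n : ℕ) (ω : ℕ → (Fin a → E) × (Fin b → E)) =>
      (√(1 / ((∑ i ∈ range n, ∑ l, Real.sigmoid (dhat n ω - M - W ((ω i).1 l))) / n) - 1 / a - 1 / b))⁻¹)
      atTop (fun _ => (√v)⁻¹) := by
    refine tendstoInMeasure_of_tendsto_ae (fun n => (hUmeas n).aestronglyMeasurable) ?_
    filter_upwards [h.tendsto_blockOverlapHat_ae h0 h1 hΔF ha hb hdhat] with ω hω
    have hlim : Tendsto (fun n : ℕ =>
        1 / ((∑ i ∈ range n, ∑ l, Real.sigmoid (dhat n ω - M - W ((ω i).1 l))) / n) - 1 / a - 1 / b)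
        atTop (𝓝 v) :=
      ((tendsto_const_nhds.div hω hGpos.ne').sub_const _).sub_const _
    exact (hlim.sqrt).inv₀ hsv
  have slutsky := clt.continuous_comp_prodMk_of_tendstoInMeasure_const
    (g := fun p : ℝ × ℝ => p.1 * p.2) (by fun_prop) hU hUmeas
  refine slutsky.congr (fun n => Eventually.of_forall fun ω => ?_) (Eventually.of_forall fun ω' => ?_)
  · simp only [div_eq_mul_inv]
  · show √v * Z ω' * (√v)⁻¹ = Z ω'
    rw [mul_comm (√v) (Z ω'), mul_inv_cancel_right₀ hsv]

/-- **The interval `ΔF̂ ± z·√(1/(n Ĝ_n) − 1/nf − 1/nr)` is asymptotically honest** (`nf = a n`,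
`nr = b n`): for `z ≥ 0`, the probability of `|ΔF̂_n − ΔF| √n ≤ z √(1/Ĝ_n − 1/a − 1/b)` tends to
`gaussianReal 0 1 [−z, z]`. -/
theorem tendsto_measure_abs_barRoot_blocks_sub_le [IsFiniteMeasure ν₀] [IsFiniteMeasure ν₁]
    [IsMarkovKernel κF] [IsMarkovKernel κR] (h0 : ν₀ univ ≠ 0) (h1 : ν₁ univ ≠ 0)
    (h : CrooksPair ν₀ ν₁ κF κR s e W) {ΔF : ℝ}
    (hΔF : Real.exp (-ΔF) = ((ν₀ univ)⁻¹ * ν₁ univ).toReal) (ha : 0 < a) (hb : 0 < b)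
    (hv : 0 < 1 / (∫ ε, (Real.exp (ΔF - W ε) / a + 1 / b)⁻¹ ∂(fwdPathLaw ν₁ κR)) - 1 / a - 1 / b)
    {dhat : ℕ → (ℕ → (Fin a → E) × (Fin b → E)) → ℝ} (hdm : ∀ n, Measurable (dhat n))
    (hdhat : ∀ n, 1 ≤ n → ∀ ω, ∑ i ∈ range n,
      ((∑ l, Real.sigmoid (dhat n ω - Real.log ((a : ℝ) / b) - W ((ω i).1 l))) -
        ∑ l, Real.sigmoid (W ((ω i).2 l) - (dhat n ω - Real.log ((a : ℝ) / b)))) = 0)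
    {z : ℝ} (hz : 0 ≤ z) :
    haveI := isProbabilityMeasure_fwdPathLaw ν₀ h0 κF
    haveI := isProbabilityMeasure_fwdPathLaw ν₁ h1 κR
    Tendsto (fun n : ℕ => (Measure.infinitePi fun _ : ℕ =>
        (Measure.pi fun _ : Fin a => fwdPathLaw ν₀ κF).prod (Measure.pi fun _ : Fin b => fwdPathLaw ν₁ κR))
        {ω | |√(n : ℝ) * (dhat n ω - ΔF) /
          √(1 / ((∑ i ∈ range n, ∑ l, Real.sigmoid (dhat n ω - Real.log ((a : ℝ) / b) - W ((ω i).1 l))) / n)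
            - 1 / a - 1 / b)| ≤ z})
      atTop (𝓝 (gaussianReal 0 1 (Icc (-z) z))) := by
  haveI := isProbabilityMeasure_fwdPathLaw ν₀ h0 κF
  haveI := isProbabilityMeasure_fwdPathLaw ν₁ h1 κR
  have hd := h.tendstoInDistribution_barRoot_blocks_studentized h0 h1 hΔF ha hb hv hdm hdhat
    (P' := gaussianReal 0 1) (Z := id) HasLaw.id
  have hnull : ((gaussianReal 0 1).map id) (frontier (Icc (-z) z)) = 0 := by
    rw [Measure.map_id, frontier_Icc (by linarith : -z ≤ z)]
    haveI := nullSingletonClass_gaussianReal (μ := 0) (v := 1) one_ne_zero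
    exact (Set.toFinite {-z, z}).measure_zero _
  have key := ProbabilityMeasure.tendsto_measure_of_null_frontier_of_tendsto' hd.tendsto
    (E := Icc (-z) z) (by simpa using hnull)
  simp only [ProbabilityMeasure.coe_mk, Measure.map_id] at key
  refine key.congr fun n => ?_
  rw [Measure.map_apply_of_aemeasurable (hd.forall_aemeasurable n) measurableSet_Icc]
  congr 1
  ext ω
  simp only [Set.mem_preimage, Set.mem_Icc, mem_setOf_eq, abs_le]

end CrooksPair

end Summit.Ventures.LatticeQCDFlow.Exactness.GeneralNCMC
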